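import Mathlib
import Literature.Computability.Complexity.PolynomialEntropyApproximation
import Literature.Computability.Complexity.PromiseCookReductions
import Literature.Computability.Complexity.PromiseCookReductionsProofs
import Summits.PneNP.PneNP.Theorems.SzkEntropyPeaThreeNotInP

/-!
# Sketch (ideator 3, crux stmt-PneNP-10776 `PeaThreeNotInP`) — card `tensor-iso-monoid-import`

First lemmas — ALL PROVED (no `sorry`) — for the line "3-Tensor Isomorphism over F₂ Cook-reduces
to `PEA 3` by MONOID randomisation, hence `TI ∉ P → X`": the monoid-action law, law invariance
under isomorphism, the Jensen–Shannon accounting lemma, and the transfer shape.  Nothing here is a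
route item; what is left to the line is bookkeeping (conciseness preprocessing, `π_n ≥ 1/64`, the
`PED 4` instance, the `PED 4 → PEA 3` Cook step).
-/

set_option linter.dupNamespace false

namespace Summit.PneNP.PneNP.Cruxes.PeaThreeNotInP.IsomorphismImport

open Literature.Computability.Complexity Literature.InformationTheory.Entropy Finset Matrix
open scoped Kronecker

variable {n : ℕ}

/-- A 3-tensor over `F₂`, presented by its first flattening `T_{i,(j,k)}` (an `n × n²` matrix). -/
abbrev Tensor3 (n : ℕ) : Type := Matrix (Fin n) (Fin n × Fin n) (ZMod 2)

/-- A triple of `n × n` matrices over `F₂` — the sample space of the monoid-randomised sampler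
(ALL matrices, not only invertible ones: no rank computation is needed, and the sampler is a cubic
map in the `3n²` matrix entries). -/
abbrev Triple (n : ℕ) : Type :=
  Matrix (Fin n) (Fin n) (ZMod 2) × Matrix (Fin n) (Fin n) (ZMod 2) × Matrix (Fin n) (Fin n) (ZMod 2)

/-- The trilinear action `(A,B,C)·T := A · T · (B ⊗ C)ᵀ`, entrywise
`((A,B,C)·T)_{a,(b,c)} = ∑_{i,j,k} A_{ai} B_{bj} C_{ck} T_{i,(j,k)}` — each entry is a polynomial
of degree exactly `3` in the entries of `(A,B,C)` ("three legs = degree three"). -/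
def tensorAct (M : Triple n) (T : Tensor3 n) : Tensor3 n :=
  M.1 * T * (M.2.1 ⊗ₖ M.2.2)ᵀ

/-- Isomorphism of 3-tensors under `GL_n(F₂)³`. -/
def Iso (S T : Tensor3 n) : Prop :=
  ∃ g : Triple n, IsUnit g.1 ∧ IsUnit g.2.1 ∧ IsUnit g.2.2 ∧ S = tensorAct g T

/-- Output entropy (bits) of the monoid-randomised sampler `M ↦ M·S`, `M` uniform on ALL triples. -/
noncomputable def samplerEntropy (S : Tensor3 n) : ℝ :=
  mapEntropy (Finset.univ : Finset (Triple n)) (fun M => tensorAct M S)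

/-- The action is a monoid action: `M·(g·T) = (M g)·T` (componentwise products). -/
theorem tensorAct_tensorAct (M g : Triple n) (T : Tensor3 n) :
    tensorAct M (tensorAct g T) = tensorAct (M.1 * g.1, M.2.1 * g.2.1, M.2.2 * g.2.2) T := by
  simp only [tensorAct, mul_kronecker_mul, Matrix.transpose_mul, Matrix.mul_assoc]

/-- Right multiplication by an invertible triple, as a permutation of ALL triples. -/
def rightMul (u₁ u₂ u₃ : (Matrix (Fin n) (Fin n) (ZMod 2))ˣ) : Triple n ≃ Triple n :=
  Equiv.prodCongr (Units.mulRight u₁) (Equiv.prodCongr (Units.mulRight u₂) (Units.mulRight u₃))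

theorem rightMul_apply (u₁ u₂ u₃ : (Matrix (Fin n) (Fin n) (ZMod 2))ˣ) (M : Triple n) :
    rightMul u₁ u₂ u₃ M = (M.1 * u₁, M.2.1 * u₂, M.2.2 * u₃) := by
  rcases M with ⟨A, B, C⟩
  rfl

/-- **First lemma (a), law invariance — PROVED.** Isomorphic tensors give IDENTICALLY DISTRIBUTED
monoid-randomised samples (right multiplication by an invertible triple permutes `Triple n`):
the `ΔH = 0` side of the reduction. -/
theorem law_eq_of_iso {S T : Tensor3 n} (h : Iso S T) (U : Tensor3 n) :
    (Finset.univ.filter fun M : Triple n => tensorAct M S = U).card =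
      (Finset.univ.filter fun M : Triple n => tensorAct M T = U).card := by
  obtain ⟨g, ⟨u₁, hu₁⟩, ⟨u₂, hu₂⟩, ⟨u₃, hu₃⟩, rfl⟩ := h
  have he : ∀ M : Triple n, tensorAct M (tensorAct g T) = tensorAct (rightMul u₁ u₂ u₃ M) T := by
    intro M
    rw [tensorAct_tensorAct, rightMul_apply, hu₁, hu₂, hu₃]
  have hset : (Finset.univ.filter fun M : Triple n => tensorAct M (tensorAct g T) = U) =
      (Finset.univ.filter fun M : Triple n => tensorAct M T = U).map
        (rightMul u₁ u₂ u₃).symm.toEmbedding := by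
    ext M
    simp only [Finset.mem_filter, Finset.mem_univ, true_and, Finset.mem_map_equiv,
      Equiv.symm_symm, he]
  rw [hset, Finset.card_map]

/-- Hence equal sampler entropies for isomorphic tensors — PROVED (re-indexing invariance of
`mapEntropy`, tree lemma `mapEntropy_univ_comp_equiv`). -/
theorem samplerEntropy_eq_of_iso {S T : Tensor3 n} (h : Iso S T) :
    samplerEntropy S = samplerEntropy T := by
  obtain ⟨g, ⟨u₁, hu₁⟩, ⟨u₂, hu₂⟩, ⟨u₃, hu₃⟩, rfl⟩ := h
  have he : (fun M : Triple n => tensorAct M T) ∘ (rightMul u₁ u₂ u₃) =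
      fun M : Triple n => tensorAct M (tensorAct g T) := by
    funext M
    simp only [Function.comp_apply, tensorAct_tensorAct, rightMul_apply, hu₁, hu₂, hu₃]
  unfold samplerEntropy
  rw [← he]
  exact Literature.InformationTheory.Entropy.mapEntropy_univ_comp_equiv (rightMul u₁ u₂ u₃) _

/-! ### First lemma (b): the Jensen–Shannon accounting — PROVED

If two maps `f, g` on the same uniform sample space hit an event `E` with the same probability `π`
and their `E`-parts have disjoint images, then the fair mixture gains at least `π` bits over the
average entropy: `H(mix) ≥ (H f + H g)/2 + π` (log-sum inequality termwise on the image, and the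
`E`-terms contribute exactly `π` each side).  Applied with `E` = "all three flattening ranks are
full" (probability `π_n = ∏(1-2⁻ⁱ)³ ≥ 1/64` under BOTH samplers, images = the two disjoint
`GL³`-orbits when `S ≇ T` are concise). -/

section JSD


/-- Tangent bound `log₂ x ≥ (1 - 1/x) / ln 2` for `x > 0`. -/
theorem one_sub_inv_div_log_two_le_logb {x : ℝ} (hx : 0 < x) :
    (1 - x⁻¹) / Real.log 2 ≤ Real.logb 2 x := by
  have hlog2 : 0 < Real.log 2 := Real.log_pos (by norm_num)
  unfold Real.logb
  rw [div_le_div_iff_of_pos_right hlog2]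
  have h := Real.log_le_sub_one_of_pos (inv_pos.2 hx)
  rw [Real.log_inv] at h
  linarith

/-- Termwise nonnegativity `a log₂(2a/(a+b)) + b log₂(2b/(a+b)) ≥ 0` (log-sum inequality,
two-point case), with Lean's junk conventions at `a = 0` or `b = 0`. -/
theorem termwise_nonneg {a b : ℝ} (ha : 0 ≤ a) (hb : 0 ≤ b) (hab : 0 < a + b) :
    0 ≤ a * Real.logb 2 (2 * a / (a + b)) + b * Real.logb 2 (2 * b / (a + b)) := by
  have hlog2 : 0 < Real.log 2 := Real.log_pos (by norm_num)
  -- linear lower bounds for each term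
  have key : ∀ {c : ℝ}, 0 ≤ c →
      c * ((1 - (2 * c / (a + b))⁻¹) / Real.log 2) ≤ c * Real.logb 2 (2 * c / (a + b)) := by
    intro c hc
    rcases hc.lt_or_eq with hc' | h0
    · exact mul_le_mul_of_nonneg_left (one_sub_inv_div_log_two_le_logb (by positivity)) hc'.le
    · subst h0; simp
  have h1 := key ha
  have h2 := key hb
  -- the linear bounds sum to something nonnegative
  have hsum : 0 ≤ a * (1 - (2 * a / (a + b))⁻¹) + b * (1 - (2 * b / (a + b))⁻¹) := by
    rcases ha.lt_or_eq with ha' | ha0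
    · rcases hb.lt_or_eq with hb' | hb0
      · have : a * (1 - (2 * a / (a + b))⁻¹) + b * (1 - (2 * b / (a + b))⁻¹) = 0 := by
          field_simp
          ring
        rw [this]
      · subst hb0
        have : (2 * a / (a + 0))⁻¹ = 1 / 2 := by
          rw [add_zero, mul_div_assoc, div_self ha'.ne', mul_one, one_div]
        rw [this]
        norm_num
        linarith
    · subst ha0
      have hb' : 0 < b := by linarith
      have : (2 * b / (0 + b))⁻¹ = 1 / 2 := by
        rw [zero_add, mul_div_assoc, div_self hb'.ne', mul_one, one_div]
      rw [this]
      norm_num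
      linarith
  have hsum' : 0 ≤ a * ((1 - (2 * a / (a + b))⁻¹) / Real.log 2) +
      b * ((1 - (2 * b / (a + b))⁻¹) / Real.log 2) := by
    have : a * ((1 - (2 * a / (a + b))⁻¹) / Real.log 2) +
        b * ((1 - (2 * b / (a + b))⁻¹) / Real.log 2) =
        (a * (1 - (2 * a / (a + b))⁻¹) + b * (1 - (2 * b / (a + b))⁻¹)) / Real.log 2 := by
      ring
    rw [this]
    exact div_nonneg hsum hlog2.le
  linarith

/-- Exact value when the second side vanishes: `a log₂(2a/a) + 0 = a`. -/
theorem termwise_eq_left {a : ℝ} (ha : 0 < a) :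
    a * Real.logb 2 (2 * a / (a + 0)) + 0 * Real.logb 2 (2 * 0 / (a + 0)) = a := by
  have : 2 * a / (a + 0) = 2 := by
    rw [add_zero, mul_div_assoc, div_self ha.ne', mul_one]
  rw [this, Real.logb_self_eq_one (by norm_num : (1:ℝ) < 2)]
  ring

/-- Exact value when the first side vanishes. -/
theorem termwise_eq_right {b : ℝ} (hb : 0 < b) :
    0 * Real.logb 2 (2 * 0 / (0 + b)) + b * Real.logb 2 (2 * b / (0 + b)) = b := by
  have : 2 * b / (0 + b) = 2 := by
    rw [zero_add, mul_div_assoc, div_self hb.ne', mul_one]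
  rw [this, Real.logb_self_eq_one (by norm_num : (1:ℝ) < 2)]
  ring

variable {ι β : Type*} [Fintype ι] [DecidableEq β]

theorem card_fiber_univ_eq_zero_iff (f : ι → β) (y : β) :
    (fiber (univ : Finset ι) f y).card = 0 ↔ y ∉ (univ : Finset ι).image f := by
  rw [Finset.card_eq_zero, Finset.mem_image]
  constructor
  · rintro h ⟨i, -, rfl⟩
    have : i ∈ fiber univ f (f i) := self_mem_fiber f (mem_univ i)
    rw [h] at this
    simp at this
  · intro h
    ext i
    simp only [mem_fiber, mem_univ, true_and, Finset.notMem_empty, iff_false]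
    intro hi
    exact h ⟨i, mem_univ i, hi⟩

/-- **First lemma (b), the Jensen–Shannon accounting lemma — PROVED.** -/
theorem mixture_entropy_ge [Nonempty ι]
    (f g : ι → β) (E : Set β) [DecidablePred (· ∈ E)] (π : ℝ)
    (hf : ((Finset.univ.filter fun i => f i ∈ E).card : ℝ) = π * Fintype.card ι)
    (hg : ((Finset.univ.filter fun i => g i ∈ E).card : ℝ) = π * Fintype.card ι)
    (hdisj : ∀ i j, f i ∈ E → g j ∈ E → f i ≠ g j) :
    (mapEntropy Finset.univ f + mapEntropy Finset.univ g) / 2 + π ≤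
      mapEntropy (Finset.univ : Finset (Bool × ι)) (fun p => if p.1 then f p.2 else g p.2) := by
  classical
  -- notation
  set m : Bool × ι → β := fun p => if p.1 then f p.2 else g p.2 with hm
  set N : ℝ := (Fintype.card ι : ℝ) with hNdef
  have hN : 0 < N := by
    rw [hNdef]; exact_mod_cast Fintype.card_pos
  set a : β → ℝ := fun y => ((fiber (univ : Finset ι) f y).card : ℝ) with hadef
  set b : β → ℝ := fun y => ((fiber (univ : Finset ι) g y).card : ℝ) with hbdef
  have ha_nn : ∀ y, 0 ≤ a y := fun y => by rw [hadef]; positivity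
  have hb_nn : ∀ y, 0 ≤ b y := fun y => by rw [hbdef]; positivity
  have ha_pos : ∀ i, 0 < a (f i) := fun i => by
    simp only [hadef]; exact_mod_cast card_fiber_pos f (mem_univ i)
  have hb_pos : ∀ j, 0 < b (g j) := fun j => by
    simp only [hbdef]; exact_mod_cast card_fiber_pos g (mem_univ j)
  have ha_zero_iff : ∀ y, a y = 0 ↔ y ∉ univ.image f := fun y => by
    simp only [hadef, Nat.cast_eq_zero]; exact card_fiber_univ_eq_zero_iff f y
  have hb_zero_iff : ∀ y, b y = 0 ↔ y ∉ univ.image g := fun y => by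
    simp only [hbdef, Nat.cast_eq_zero]; exact card_fiber_univ_eq_zero_iff g y
  -- fibres of the mixture map: |m⁻¹(y)| = |f⁻¹(y)| + |g⁻¹(y)|
  have hfib : ∀ y, ((fiber (univ : Finset (Bool × ι)) m y).card : ℝ) = a y + b y := by
    intro y
    simp only [hadef, hbdef, fiber, Finset.card_filter, Fintype.sum_prod_type, Fintype.sum_bool,
      hm]
    push_cast
    simp
  -- the sample-space cardinality of the mixture
  have hcard : (((univ : Finset (Bool × ι)).card : ℕ) : ℝ) = 2 * N := by
    rw [Finset.card_univ, Fintype.card_prod, Fintype.card_bool, hNdef]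
    push_cast
    ring
  -- Step 1: write the three entropies as sums over ι
  have Hm : mapEntropy (univ : Finset (Bool × ι)) m =
      ((∑ i, Real.logb 2 (2 * N / (a (f i) + b (f i)))) +
        ∑ i, Real.logb 2 (2 * N / (a (g i) + b (g i)))) / (2 * N) := by
    unfold mapEntropy
    rw [hcard]
    congr 1
    rw [Fintype.sum_prod_type, Fintype.sum_bool]
    congr 1
    · refine Finset.sum_congr rfl fun i _ => ?_
      rw [hfib]
      simp [hm]
    · refine Finset.sum_congr rfl fun i _ => ?_
      rw [hfib]
      simp [hm]
  have Hf : mapEntropy (univ : Finset ι) f = (∑ i, Real.logb 2 (N / a (f i))) / N := by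
    simp only [mapEntropy, Finset.card_univ, hNdef, hadef]
  have Hg : mapEntropy (univ : Finset ι) g = (∑ i, Real.logb 2 (N / b (g i))) / N := by
    simp only [mapEntropy, Finset.card_univ, hNdef, hbdef]
  -- Step 2: pointwise quotient identity
  have hquot : ∀ {c d : ℝ}, 0 < c → 0 ≤ d →
      Real.logb 2 (2 * N / (c + d)) - Real.logb 2 (N / c) = Real.logb 2 (2 * c / (c + d)) := by
    intro c d hc hd
    have hcd : 0 < c + d := by linarith
    rw [← Real.logb_div (by positivity) (by positivity)]
    congr 1
    field_simp
  -- the deficit sum D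
  set u : β → ℝ := fun y => Real.logb 2 (2 * a y / (a y + b y)) with hudef
  set v : β → ℝ := fun y => Real.logb 2 (2 * b y / (a y + b y)) with hvdef
  -- Step 3: reduce the goal to a statement about D
  have hgoal : (∑ i, Real.logb 2 (N / a (f i))) + (∑ i, Real.logb 2 (N / b (g i))) + 2 * N * π ≤
      (∑ i, Real.logb 2 (2 * N / (a (f i) + b (f i)))) +
        ∑ i, Real.logb 2 (2 * N / (a (g i) + b (g i))) := by
    -- D = ∑ u (f i) + ∑ v (g i) ≥ 2 N π
    have hDf : ∑ i, Real.logb 2 (2 * N / (a (f i) + b (f i))) - ∑ i, Real.logb 2 (N / a (f i)) =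
        ∑ i, u (f i) := by
      rw [← Finset.sum_sub_distrib]
      refine Finset.sum_congr rfl fun i _ => ?_
      rw [hudef]
      exact hquot (ha_pos i) (hb_nn _)
    have hDg : ∑ i, Real.logb 2 (2 * N / (a (g i) + b (g i))) - ∑ i, Real.logb 2 (N / b (g i)) =
        ∑ i, v (g i) := by
      rw [← Finset.sum_sub_distrib]
      refine Finset.sum_congr rfl fun i _ => ?_
      have := hquot (hb_pos i) (ha_nn (g i))
      -- hquot with roles swapped: 2N/(b + a) vs (a + b)
      rw [add_comm (b (g i)) (a (g i))] at this
      rw [this]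
    -- regroup over the image
    set Y : Finset β := univ.image f ∪ univ.image g with hYdef
    have hregf : ∑ i, u (f i) = ∑ y ∈ Y, a y * u y := by
      rw [Finset.sum_comp u f]
      have : ∑ y ∈ univ.image f, (univ.filter fun i => f i = y).card • u y =
          ∑ y ∈ univ.image f, a y * u y := by
        refine Finset.sum_congr rfl fun y _ => ?_
        rw [nsmul_eq_mul, hadef]
        rfl
      rw [this]
      refine Finset.sum_subset Finset.subset_union_left fun y hyY hy => ?_
      rw [(ha_zero_iff y).2 hy, zero_mul]
    have hregg : ∑ i, v (g i) = ∑ y ∈ Y, b y * v y := by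
      rw [Finset.sum_comp v g]
      have : ∑ y ∈ univ.image g, (univ.filter fun i => g i = y).card • v y =
          ∑ y ∈ univ.image g, b y * v y := by
        refine Finset.sum_congr rfl fun y _ => ?_
        rw [nsmul_eq_mul, hbdef]
        rfl
      rw [this]
      refine Finset.sum_subset Finset.subset_union_right fun y hyY hy => ?_
      rw [(hb_zero_iff y).2 hy, zero_mul]
    -- termwise bounds on Y
    have hYpos : ∀ y ∈ Y, 0 < a y + b y := by
      intro y hy
      rw [hYdef, Finset.mem_union] at hy
      rcases hy with hy | hy
      · have h1 : a y ≠ 0 := fun h => (ha_zero_iff y).1 h hy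
        have h2 := ha_nn y
        have h3 := hb_nn y
        have h4 : 0 < a y := lt_of_le_of_ne h2 (Ne.symm h1)
        linarith
      · have h1 : b y ≠ 0 := fun h => (hb_zero_iff y).1 h hy
        have h2 := ha_nn y
        have h3 := hb_nn y
        have h4 : 0 < b y := lt_of_le_of_ne h3 (Ne.symm h1)
        linarith
    have hterm_nn : ∀ y ∈ Y, 0 ≤ a y * u y + b y * v y := fun y hy =>
      termwise_nonneg (ha_nn y) (hb_nn y) (hYpos y hy)
    have hterm_E : ∀ y ∈ Y, y ∈ E → a y * u y + b y * v y = a y + b y := by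
      intro y hy hyE
      -- one of the two fibres is empty
      by_cases hay : a y = 0
      · have hby : 0 < b y := by have := hYpos y hy; rw [hay, zero_add] at this; exact this
        have key := termwise_eq_right hby
        rw [hudef, hvdef]
        simp only [hay, zero_add] at key ⊢
        simpa using key
      · by_cases hby : b y = 0
        · have hay' : 0 < a y := lt_of_le_of_ne (ha_nn y) (Ne.symm hay)
          have key := termwise_eq_left hay'
          rw [hudef, hvdef]
          simp only [hby, add_zero] at key ⊢
          simpa using key
        · -- both fibres nonempty: contradiction with disjointness on E
          exfalso
          have hfa : y ∈ univ.image f := by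
            by_contra h
            exact hay ((ha_zero_iff y).2 h)
          have hgb : y ∈ univ.image g := by
            by_contra h
            exact hby ((hb_zero_iff y).2 h)
          obtain ⟨i, -, hi⟩ := Finset.mem_image.1 hfa
          obtain ⟨j, -, hj⟩ := Finset.mem_image.1 hgb
          exact hdisj i j (hi ▸ hyE) (hj ▸ hyE) (hi.trans hj.symm)
    -- sum over Y ≥ sum over Y ∩ E of (a + b)
    have hsumY : ∑ y ∈ Y.filter (· ∈ E), (a y + b y) ≤ ∑ y ∈ Y, (a y * u y + b y * v y) := by
      rw [← Finset.sum_filter_add_sum_filter_not Y (· ∈ E)]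
      have h1 : ∑ y ∈ Y.filter (· ∈ E), (a y * u y + b y * v y) =
          ∑ y ∈ Y.filter (· ∈ E), (a y + b y) := by
        refine Finset.sum_congr rfl fun y hy => ?_
        rw [Finset.mem_filter] at hy
        exact hterm_E y hy.1 hy.2
      have h2 : 0 ≤ ∑ y ∈ Y.filter (fun y => ¬ y ∈ E), (a y * u y + b y * v y) :=
        Finset.sum_nonneg fun y hy => hterm_nn y (Finset.mem_filter.1 hy).1
      linarith
    -- the E-sums are the E-counts
    have hEa : ∑ y ∈ Y.filter (· ∈ E), a y = π * N := by
      rw [← hf]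
      have hmaps : ∀ i ∈ univ.filter (fun i => f i ∈ E), f i ∈ Y.filter (· ∈ E) := by
        intro i hi
        rw [Finset.mem_filter] at hi ⊢
        exact ⟨by rw [hYdef]; exact Finset.mem_union_left _ (Finset.mem_image_of_mem f (mem_univ i)), hi.2⟩
      rw [Finset.card_eq_sum_card_fiberwise hmaps]
      push_cast
      refine Finset.sum_congr rfl fun y hy => ?_
      rw [Finset.mem_filter] at hy
      have hset : ((univ.filter fun i => f i ∈ E).filter fun i => f i = y) = fiber univ f y := by
        rw [Finset.filter_filter]
        unfold fiber
        refine Finset.filter_congr fun i _ => ?_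
        exact ⟨fun h => h.2, fun h => ⟨by rw [h]; exact hy.2, h⟩⟩
      rw [hset]
    have hEb : ∑ y ∈ Y.filter (· ∈ E), b y = π * N := by
      rw [← hg]
      have hmaps : ∀ j ∈ univ.filter (fun j => g j ∈ E), g j ∈ Y.filter (· ∈ E) := by
        intro j hj
        rw [Finset.mem_filter] at hj ⊢
        exact ⟨by rw [hYdef]; exact Finset.mem_union_right _ (Finset.mem_image_of_mem g (mem_univ j)), hj.2⟩
      rw [Finset.card_eq_sum_card_fiberwise hmaps]
      push_cast
      refine Finset.sum_congr rfl fun y hy => ?_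
      rw [Finset.mem_filter] at hy
      have hset : ((univ.filter fun j => g j ∈ E).filter fun j => g j = y) = fiber univ g y := by
        rw [Finset.filter_filter]
        unfold fiber
        refine Finset.filter_congr fun j _ => ?_
        exact ⟨fun h => h.2, fun h => ⟨by rw [h]; exact hy.2, h⟩⟩
      rw [hset]
    have hsumE : ∑ y ∈ Y.filter (· ∈ E), (a y + b y) = 2 * N * π := by
      rw [Finset.sum_add_distrib, hEa, hEb]; ring
    -- assemble
    have hD : 2 * N * π ≤ ∑ i, u (f i) + ∑ i, v (g i) := by
      rw [hregf, hregg, ← Finset.sum_add_distrib, ← hsumE]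
      exact hsumY
    linarith [hDf, hDg, hD]
  -- Step 4: conclude
  rw [Hm, Hf, Hg]
  have hL : ((∑ i, Real.logb 2 (N / a (f i))) / N + (∑ i, Real.logb 2 (N / b (g i))) / N) / 2 + π =
      ((∑ i, Real.logb 2 (N / a (f i))) + (∑ i, Real.logb 2 (N / b (g i))) + 2 * N * π) / (2 * N) := by
    field_simp
  rw [hL]
  exact div_le_div_of_nonneg_right hgoal (by positivity)


end JSD


/-- **Transfer shape — PROVED.**  Any language that Cook-reduces to `PEA 3` and lies outside `P`
yields thesis X.  The line instantiates `TI` := 3-Tensor Isomorphism over `F₂` (Grochow–Qiao's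
TI-complete class) with the reduction: conciseness preprocessing → monoid-randomised
mixture/product pair `(p_{128}, q'_{64})` (degree 4) → `PED 4` → `PEA` thresholds by binary
search on products → `PEA 3` (`PEA_polyTimeReducible_PEA_three`). -/
theorem peaThreeNotInP_of_cookHard {TI : Language Bool}
    (hred : (PromiseProblem.ofLanguage TI).CookReducible (PEA 3)) (hTI : TI ∉ Classes.P) :
    Summit.PneNP.PneNP.Theses.SzkEntropy.PeaThreeNotInP := by
  refine Summit.PneNP.PneNP.Theorems.szkEntropy_peaThreeNotInP_iff.2 fun hP => hTI ?_
  exact ofLanguage_mem_promiseLift_iff.1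
    (PromiseProblem.mem_PromiseP_of_cookReducible_holds _ _ hred hP)

end Summit.PneNP.PneNP.Cruxes.PeaThreeNotInP.IsomorphismImport
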